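import Literature.Probability.RandomPlanarGeometry.ConformalRectangle
import Mathlib.Analysis.Calculus.Deriv.Slope
import Mathlib.Analysis.SpecialFunctions.Pow.Asymptotics

/-!
# Box exhaustion for the collinear half-plane Cardy statement, part 5: real-analysis lemmas

Support file (line `Sketch`, stub `stub_collinearCardy`, crux `HalfPlaneMarkDensityLaw`,
stmt-CriticalPhenomena-5661; transfer `RectilinearCardy → stub_collinearCardy`).

* `continuousAt_crossRatio`: Cardy's cross-ratio is continuous off its poles;
* `tendsto_crossRatio_of_preimages`: if `G` is strictly increasing on `[-1,1]`, `G 0 = 0`, `G'(0) = 1`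
  and `U t` are `G`-preimages of the shrinking collinear marks `t·q` (`G (U t i) = t qᵢ`), then
  `crossRatio (U t) → crossRatio q` as `t → 0⁺` (scale invariance of the cross-ratio and
  `U t i / t → qᵢ`): the conformal modulus of the box with marks `t·q` tends to the HALF-PLANE
  cross-ratio of `q`;
* `tendsto_of_sandwich`: an `ε`-sandwich criterion for convergence of a real sequence;
* small helpers (`abs_le_of_floor_bounds`, `tendsto_const_mul_inv_rpow`, `continuous_marks_sub`).
-/

noncomputable section

namespace Summit.CriticalPhenomena.CardyFormulaZ2.Cruxes.HalfPlaneMarkDensityLaw.SketchLine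

open Set Filter Topology
open Literature.Probability.RandomPlanarGeometry

namespace BoxExhaustion

/-! ## The cross-ratio -/

/-- Cardy's cross-ratio is continuous at every tuple off its poles. [folklore] -/
theorem continuousAt_crossRatio {x : Fin 4 → ℝ} (h : (x 0 - x 2) * (x 1 - x 3) ≠ 0) :
    ContinuousAt crossRatio x := by
  have e : crossRatio = fun x : Fin 4 → ℝ => (x 0 - x 1) * (x 2 - x 3) / ((x 0 - x 2) * (x 1 - x 3)) :=
    rfl
  rw [e]
  refine ContinuousAt.div ?_ ?_ h <;> fun_prop

/-- A strictly monotone tuple is off the poles of the cross-ratio. [folklore] -/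
theorem crossRatio_den_ne_zero {x : Fin 4 → ℝ} (hx : StrictMono x) : (x 0 - x 2) * (x 1 - x 3) ≠ 0 := by
  have h02 : x 0 < x 2 := hx (by decide)
  have h13 : x 1 < x 3 := hx (by decide)
  exact mul_ne_zero (by linarith) (by linarith)

/-- The marks `(a - ε', b, c - ε', y)` depend continuously on `ε'`. [folklore] -/
theorem continuous_marks_sub (a b c y : ℝ) :
    Continuous fun ε' : ℝ => (![a - ε', b, c - ε', y] : Fin 4 → ℝ) := by
  refine continuous_pi fun i => ?_
  fin_cases i <;> simp <;> fun_prop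

/-! ## The modulus of the box with shrinking collinear marks -/

/-- **Shrinking collinear marks.** Let `G` be strictly increasing on `[-1, 1]` with `G 0 = 0` and
`G' (0) = 1`, `q` a strictly increasing `4`-tuple, and `U t` (`t → 0⁺`) tuples in `[-1,1]` with
`G (U t i) = t qᵢ`. Then `crossRatio (U t) → crossRatio q`: indeed `U t i → 0`,
`U t i / t → qᵢ` (difference quotient of `G` at `0`) and the cross-ratio is scale invariant and
continuous at `q`. [folklore] -/
theorem tendsto_crossRatio_of_preimages {G : ℝ → ℝ} (hGm : StrictMonoOn G (Icc (-1) 1))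
    (hG0 : G 0 = 0) (hGd : HasDerivAt G 1 0) {q : Fin 4 → ℝ} (hq : StrictMono q)
    {U : ℝ → Fin 4 → ℝ} (hU : ∀ᶠ t in 𝓝[>] 0, ∀ i, U t i ∈ Icc (-1 : ℝ) 1 ∧ G (U t i) = t * q i) :
    Tendsto (fun t => crossRatio (U t)) (𝓝[>] 0) (𝓝 (crossRatio q)) := by
  have h0mem : (0 : ℝ) ∈ Icc (-1 : ℝ) 1 := ⟨by norm_num, by norm_num⟩
  -- Step A: `U t i → 0`
  have hA : ∀ i, Tendsto (fun t => U t i) (𝓝[>] 0) (𝓝 0) := by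
    intro i
    rw [Metric.tendsto_nhds]
    intro ε hε
    set ε₁ := min ε 1 with hε₁
    have hε₁0 : 0 < ε₁ := lt_min hε one_pos
    have hε₁1 : ε₁ ≤ 1 := min_le_right _ _
    have hε₁ε : ε₁ ≤ ε := min_le_left _ _
    have hmem1 : ε₁ ∈ Icc (-1 : ℝ) 1 := ⟨by linarith, hε₁1⟩
    have hmem2 : -ε₁ ∈ Icc (-1 : ℝ) 1 := ⟨by linarith, by linarith⟩
    have hGpos : 0 < G ε₁ := by
      have := hGm h0mem hmem1 hε₁0; rwa [hG0] at this
    have hGneg : G (-ε₁) < 0 := by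
      have := hGm hmem2 h0mem (by linarith); rwa [hG0] at this
    have ht0 : Tendsto (fun t : ℝ => t * q i) (𝓝[>] 0) (𝓝 0) := by
      have : Tendsto (fun t : ℝ => t * q i) (𝓝 0) (𝓝 (0 * q i)) := tendsto_id.mul_const _
      rw [zero_mul] at this
      exact this.mono_left nhdsWithin_le_nhds
    have hev : ∀ᶠ t in 𝓝[>] 0, t * q i ∈ Ioo (G (-ε₁)) (G ε₁) := ht0 (Ioo_mem_nhds hGneg hGpos)
    filter_upwards [hev, hU] with t ht htU
    obtain ⟨hmem, hGU⟩ := htU i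
    rw [dist_zero_right, Real.norm_eq_abs, abs_lt]
    constructor
    · by_contra h
      push Not at h
      have hle : U t i ≤ -ε₁ := by linarith
      have := hGm.monotoneOn hmem hmem2 hle
      rw [hGU] at this
      linarith [ht.1]
    · by_contra h
      push Not at h
      have hle : ε₁ ≤ U t i := by linarith
      have := hGm.monotoneOn hmem1 hmem hle
      rw [hGU] at this
      linarith [ht.2]
  -- Step B: `U t i / t → q i`
  have hB : ∀ i, Tendsto (fun t => U t i / t) (𝓝[>] 0) (𝓝 (q i)) := by
    intro i
    by_cases hqi : q i = 0
    · have hev : (fun _ : ℝ => q i) =ᶠ[𝓝[>] 0] fun t => U t i / t := by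
        filter_upwards [hU] with t htU
        obtain ⟨hmem, hGU⟩ := htU i
        rw [hqi, mul_zero, ← hG0] at hGU
        have : U t i = 0 := hGm.injOn hmem h0mem hGU
        rw [this, zero_div, hqi]
      exact tendsto_const_nhds.congr' hev
    · have hslope : Tendsto (slope G 0) (𝓝[≠] 0) (𝓝 1) := hasDerivAt_iff_tendsto_slope.1 hGd
      have hU0 : ∀ᶠ t in 𝓝[>] 0, U t i ≠ 0 ∧ G (U t i) = t * q i ∧ 0 < t := by
        filter_upwards [hU, self_mem_nhdsWithin] with t htU ht
        obtain ⟨-, hGU⟩ := htU i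
        refine ⟨fun h0 => ?_, hGU, ht⟩
        rw [h0, hG0] at hGU
        exact mul_ne_zero (ne_of_gt ht) hqi hGU.symm
      have hA' : Tendsto (fun t => U t i) (𝓝[>] 0) (𝓝[≠] 0) :=
        tendsto_nhdsWithin_iff.2 ⟨hA i, hU0.mono fun t ht => ht.1⟩
      have h1 : Tendsto (fun t => slope G 0 (U t i)) (𝓝[>] 0) (𝓝 1) := hslope.comp hA'
      have h2 : Tendsto (fun t => q i / slope G 0 (U t i)) (𝓝[>] 0) (𝓝 (q i / 1)) :=
        tendsto_const_nhds.div h1 one_ne_zero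
      rw [div_one] at h2
      refine h2.congr' ?_
      filter_upwards [hU0] with t ht
      obtain ⟨hne, hGU, htpos⟩ := ht
      rw [slope_def_field, hG0, sub_zero, sub_zero, hGU]
      field_simp
  -- Step C: scale invariance and continuity
  have hC : Tendsto (fun t => fun i => U t i / t) (𝓝[>] 0) (𝓝 q) := tendsto_pi_nhds.2 hB
  have hcont : ContinuousAt crossRatio q := continuousAt_crossRatio (crossRatio_den_ne_zero hq)
  refine (hcont.tendsto.comp hC).congr' ?_
  filter_upwards [self_mem_nhdsWithin] with t ht
  have := crossRatio_affine (U t) (inv_ne_zero (ne_of_gt ht)) 0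
  simp only [add_zero] at this
  rw [Function.comp_apply, ← this]
  congr 1
  funext i
  rw [div_eq_inv_mul]

/-! ## Bookkeeping lemmas -/

/-- An `ε`-sandwich criterion: if for every `ε > 0` the sequence is eventually squeezed between two
convergent sequences whose limits are `ε`-close to `L` (with slack `ε` above), it converges to `L`.
[folklore] -/
theorem tendsto_of_sandwich {P : ℕ → ℝ} {L : ℝ}
    (h : ∀ ε > 0, ∃ (lo hi : ℕ → ℝ) (ℓ₁ ℓ₂ : ℝ), Tendsto lo atTop (𝓝 ℓ₁) ∧ Tendsto hi atTop (𝓝 ℓ₂) ∧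
      L - ε < ℓ₁ ∧ ℓ₂ < L + ε ∧ ∀ᶠ n in atTop, lo n ≤ P n ∧ P n ≤ hi n + ε) :
    Tendsto P atTop (𝓝 L) := by
  rw [Metric.tendsto_atTop]
  intro ε hε
  obtain ⟨lo, hi, ℓ₁, ℓ₂, hlo, hhi, h1, h2, hev⟩ := h (ε / 3) (by positivity)
  have hlo' : ∀ᶠ n in atTop, ℓ₁ - ε / 3 < lo n :=
    hlo (Ioi_mem_nhds (by linarith))
  have hhi' : ∀ᶠ n in atTop, hi n < ℓ₂ + ε / 3 :=
    hhi (Iio_mem_nhds (by linarith))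
  obtain ⟨N, hN⟩ := (hev.and (hlo'.and hhi')).exists_forall_of_atTop
  refine ⟨N, fun n hn => ?_⟩
  obtain ⟨⟨hP1, hP2⟩, hl, hh⟩ := hN n hn
  rw [Real.dist_eq, abs_lt]
  constructor <;> linarith

/-- The integers between `⌊a n⌋` and `⌊b n⌋` have modulus at most `(⌈|a|⌉ + ⌈|b|⌉ + 1) n`.
[folklore] -/
theorem abs_le_of_floor_bounds {a b : ℝ} {n : ℕ} (hn : 1 ≤ n) {m : ℤ} (h1 : ⌊a * n⌋ ≤ m)
    (h2 : m ≤ ⌊b * n⌋) : |m| ≤ ((⌈|a|⌉₊ + ⌈|b|⌉₊ + 1 : ℕ) : ℤ) * n := by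
  have hn' : (1 : ℝ) ≤ n := by exact_mod_cast hn
  have ha : |a| ≤ ⌈|a|⌉₊ := Nat.le_ceil _
  have hb : |b| ≤ ⌈|b|⌉₊ := Nat.le_ceil _
  have h1' : (⌊a * n⌋ : ℝ) ≤ m := by exact_mod_cast h1
  have h2' : (m : ℝ) ≤ ⌊b * n⌋ := by exact_mod_cast h2
  have h3 : a * n - 1 < ⌊a * n⌋ := Int.sub_one_lt_floor _
  have h4 : (⌊b * n⌋ : ℝ) ≤ b * n := Int.floor_le _
  have haa : -|a| ≤ a := neg_abs_le a
  have hbb : b ≤ |b| := le_abs_self b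
  have hA0 : (0 : ℝ) ≤ ⌈|a|⌉₊ := Nat.cast_nonneg _
  have hB0 : (0 : ℝ) ≤ ⌈|b|⌉₊ := Nat.cast_nonneg _
  have key : |(m : ℝ)| ≤ ((⌈|a|⌉₊ : ℝ) + ⌈|b|⌉₊ + 1) * n := by
    rw [abs_le]
    constructor
    · nlinarith [mul_le_mul_of_nonneg_right ha (by linarith : (0 : ℝ) ≤ n),
        mul_le_mul_of_nonneg_right haa (by linarith : (0 : ℝ) ≤ n)]
    · nlinarith [mul_le_mul_of_nonneg_right hb (by linarith : (0 : ℝ) ≤ n),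
        mul_le_mul_of_nonneg_right hbb (by linarith : (0 : ℝ) ≤ n)]
  have : ((|m| : ℤ) : ℝ) ≤ (((⌈|a|⌉₊ + ⌈|b|⌉₊ + 1 : ℕ) : ℤ) * n : ℤ) := by
    push_cast; linarith
  exact_mod_cast this

/-- `C (1/L)^α → 0` as `L → ∞` (`α > 0`). [folklore] -/
theorem tendsto_const_mul_inv_rpow (C : ℝ) {α : ℝ} (hα : 0 < α) :
    Tendsto (fun L : ℕ => C * ((L : ℝ)⁻¹) ^ α) atTop (𝓝 0) := by
  have h1 : Tendsto (fun L : ℕ => (L : ℝ) ^ (-α)) atTop (𝓝 0) :=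
    (tendsto_rpow_neg_atTop hα).comp tendsto_natCast_atTop_atTop
  have h2 : (fun L : ℕ => C * ((L : ℝ)⁻¹) ^ α) = fun L : ℕ => C * ((L : ℝ) ^ (-α)) := by
    funext L
    rw [Real.inv_rpow (Nat.cast_nonneg L), Real.rpow_neg (Nat.cast_nonneg L)]
  rw [h2]
  simpa using h1.const_mul C

/-- Preimages under a strictly increasing continuous `G` on `[-1, 1]`: every value in
`(G (-1/2), G (1/2))` is attained in `(-1/2, 1/2)`. [folklore] -/
theorem exists_preimage_Ioo {G : ℝ → ℝ} (hGc : ContinuousOn G (Icc (-1) 1)) {v : ℝ}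
    (hv : v ∈ Ioo (G (-(1 / 2))) (G (1 / 2))) : ∃ u ∈ Ioo (-(1 / 2) : ℝ) (1 / 2), G u = v := by
  have hsub : Icc (-(1 / 2) : ℝ) (1 / 2) ⊆ Icc (-1) 1 := Icc_subset_Icc (by norm_num) (by norm_num)
  have := intermediate_value_Ioo (by norm_num : (-(1 / 2) : ℝ) ≤ 1 / 2) (hGc.mono hsub) hv
  obtain ⟨u, hu, rfl⟩ := this
  exact ⟨u, hu, rfl⟩

end BoxExhaustion

/-- Registered stub of this support file (part 5 of the box exhaustion): the modulus of the box with
shrinking collinear marks tends to the half-plane cross-ratio. [folklore] -/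
theorem stub_boxExhaustion_shrinkingMarks :
    ∀ (G : ℝ → ℝ) (q : Fin 4 → ℝ) (U : ℝ → Fin 4 → ℝ), StrictMonoOn G (Icc (-1) 1) → G 0 = 0 →
      HasDerivAt G 1 0 → StrictMono q →
      (∀ᶠ t in 𝓝[>] 0, ∀ i, U t i ∈ Icc (-1 : ℝ) 1 ∧ G (U t i) = t * q i) →
      Tendsto (fun t => crossRatio (U t)) (𝓝[>] 0) (𝓝 (crossRatio q)) :=
  fun _ _ _ hGm hG0 hGd hq hU => BoxExhaustion.tendsto_crossRatio_of_preimages hGm hG0 hGd hq hU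

end Summit.CriticalPhenomena.CardyFormulaZ2.Cruxes.HalfPlaneMarkDensityLaw.SketchLine

end
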